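import Summits.BirchSwinnertonDyer.BirchSwinnertonDyer.Theses.GenusKolyvaginAtTwo
import Summits.BirchSwinnertonDyer.BirchSwinnertonDyer.Theorems.GenusKolyvaginAtTwoMinimalTwinBSDTwoUniformCell
import Summits.BirchSwinnertonDyer.BirchSwinnertonDyer.Theorems.GenusKolyvaginAtTwoMinimalTwinBSDTwoAllDepthLedger
import Summits.BirchSwinnertonDyer.BirchSwinnertonDyer.Theorems.GenusKolyvaginAtTwoMinimalTwinBSDTwoAnalyticTwin
import Summits.BirchSwinnertonDyer.BirchSwinnertonDyer.Theorems.GenusKolyvaginAtTwoMinimalTwinBSDTwoRankOneTransfer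
import HarnessLib

/-!
# Route `GenusKolyvaginAtTwo`, crux U₂ `MinimalTwinBSDTwo` (stmt-BirchSwinnertonDyer-22985), LINE 23 «twin_swap» v2.3 «UNIFORM» — BY NAME:
# the item `MinimalTwinBSDTwo` from the ITEMS of routes ByReductionTypeAtTwo (WALL row 1), TwoAdicConverse (rank-zero 2-converses) and this route's
# PRINT items, plus the declared off-semistable rank-zero 2-converse and the ONE research statement KEX (the 2-primary Gross–Zagier index relation);
# and v2.4 «ANALYTIC TWIN» BY NAME: the same item from WALL row 1 + KEX′ + PRINT + Friedberg–Hoffstein, with NO 2-converse and NO residual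

Seat `bsd-line-gk2-p2` g27 (PROVER seat 2/3, cell `bsd-f1-sign2`, LINE 23 holder), `--supports stmt-BirchSwinnertonDyer-22985` (helper; closes nothing).
THEOREMS ONLY; standard axioms.  **BSD is NOT proved by this file; U₂ is NOT proved (it is the CONCLUSION of a conditional theorem whose research
hypothesis KEX is open); no item is closed.**

This is the ADOPTION / CENSUS CERTIFICATE of skeleton v2.3 (`Cruxes/MinimalTwinBSDTwo/Lines/twin_swap.lean`, ns `…TwinSwapV23`), stated Theorems-side
so that it can be cited (the Cruxes file carries the stubs' `sorry`s): in LEAD gk2-p1 g27's census currency (p783309: the leaf ⟺ WALL row 1 ∧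
`OffHabitatResidualAtTwo`; the route's non-dominated content = rank-0 → rank-1 TRANSFER theorems) it is **the transfer theorem for the whole U₂ class**
— every non-CM globally minimal curve of analytic rank `1` with `#Sel₂ = 2` is reached from WALL row 1 through a `2`-Selmer-trivial twin by a prime
Heegner discriminant, at the price of KEX (+ the rank-zero `2`-converse for the twin's central value):

* `minimalTwinBSDTwo_of_items_of_kex` : `GoodOrdinaryRankZeroAtTwo → MultiplicativeRankZeroAtTwo → SupersingularRankZeroAtTwo → AdditiveRankZeroAtTwo →`
  `GoodOrdinaryRankZeroTwoConverse → MultiplicativeRankZeroTwoConverse → (off-semistable rank-0 2-converse) → KEX → GrossZagierAllLevels →`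
  `MultPublishedInputsAtTwo → EntireLFunctionRat → MilneAnyModel → nonempty_modularParametrizationData → MinimalTwinBSDTwo`;
* `minimalTwinBSDTwo_iff_kex_of_items` : modulo the same items, **`MinimalTwinBSDTwo ↔ KEX`** (losslessness, `Uniform.kexAll_of_minimalTwinBSDTwo_of_wall_of_facts`);
* `minimalTwinBSDTwo_of_wallItems_of_friedbergHoffstein_of_kexAny` (v2.4): WALL row 1 items → KEX′ → PRINT items → BCDT → Friedberg–Hoffstein →
  `MinimalTwinBSDTwo` — NO 2-converse item, NO declared residual (`AnalyticTwin.bsdp_of_wall_of_friedbergHoffstein_of_kex_of_facts`, p786103);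
* `minimalTwinBSDTwo_iff_kexAny_of_wallItems` : modulo WALL row 1 + PRINT + FH, **`MinimalTwinBSDTwo ↔ KEX′`**;
* (appended) `nonCMAtTwo_iff_idx_of_wallItems` : given the four WALL row 1 ITEMS + PRINT + FH, **the K4 leaf `Rank1Residual.NonCMAtTwo ↔ IDX`**
  (the 2-primary Gross–Zagier index relation for non-CM rank-one curves over Friedberg–Hoffstein fields; `RankOneTransfer`, p788609).
Only the `#Sel₂ = 1` slice of WALL row 1 is used (S1, g25's `AllDepth.minimalRankZeroBSDTwo_of_wallItems`); the WALL items are quoted whole because they are the items that exist.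

References: [GrossZagier1986] V.§2 (2.2); [GrossLMS1991] §2 (2.3), §5 Prop. 5.3; [McCallumLMS1991] §5 Lemma 5.1; [MazurRubin2010] Thm. 1.5;
[Milne1972ArithmeticAV] §1 Thm. 1; [BCDTJAMS2001] Thm. A.
-/

set_option linter.dupNamespace false -- `Summit.<P>.<Sub>` repeats `BirchSwinnertonDyer` (D-0017)

noncomputable section

open scoped Classical NumberField

open WeierstrassCurve NumberField Literature.NumberTheory.EllipticCurves Literature.NumberTheory.EllipticCurves.ModularForms
open Summit.BirchSwinnertonDyer.BirchSwinnertonDyer.Theses.GenusKolyvaginAtTwo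
  (MinimalTwinBSDTwo GrossZagierAllLevels MultPublishedInputsAtTwo EntireLFunctionRat MilneAnyModel)
open Summit.BirchSwinnertonDyer.BirchSwinnertonDyer.Theses.ByReductionTypeAtTwo
  (GoodOrdinaryRankZeroAtTwo MultiplicativeRankZeroAtTwo SupersingularRankZeroAtTwo AdditiveRankZeroAtTwo)
open Summit.BirchSwinnertonDyer.BirchSwinnertonDyer.Theses.TwoAdicConverse (GoodOrdinaryRankZeroTwoConverse MultiplicativeRankZeroTwoConverse)
open Literature.NumberTheory.EllipticCurves.Rank1Residual (GoodOrd Mult)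
open Summit.BirchSwinnertonDyer.BirchSwinnertonDyer.Theorems.GenusExact.TwinSwap.Ledger.Line25 (rankZeroTwoConverse_of_items_of_offSemistable)
open Summit.BirchSwinnertonDyer.BirchSwinnertonDyer.Theorems.GenusExact.TwinSwap.Uniform
  (bsdp_of_wall_of_converse_of_kex_of_facts kexAll_of_minimalTwinBSDTwo_of_wall_of_facts)
open Summit.BirchSwinnertonDyer.BirchSwinnertonDyer.Theorems.GenusExact.TwinSwap.AllDepth (minimalRankZeroBSDTwo_of_wallItems)
open Summit.BirchSwinnertonDyer.BirchSwinnertonDyer.Theorems.GenusExact.TwinSwap.AnalyticTwin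
  (bsdp_of_wall_of_friedbergHoffstein_of_kex_of_facts kexAny_of_minimalTwinBSDTwo_of_wall_of_facts)
open Summit.BirchSwinnertonDyer.BirchSwinnertonDyer.Theorems.GenusExact.TwinSwap.RankOneTransfer
  (bsdp_rankOne_of_wall_of_friedbergHoffstein_of_idx_of_facts idx_of_bsdp_rankLeOne_of_facts)

namespace Summit.BirchSwinnertonDyer.BirchSwinnertonDyer.Theorems.GenusExact.TwinSwap.Uniform

/-- ★ **`MinimalTwinBSDTwo` (stmt-BirchSwinnertonDyer-22985) BY NAME from ITEMS + the off-semistable rank-zero 2-converse + KEX.**  Hypotheses, in order: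
the four WALL row 1 items of route ByReductionTypeAtTwo (stmt-19095–19098), the two rank-zero `2`-converse items of route TwoAdicConverse (stmt-19218,
stmt-19219), the declared residual «rank-zero `2`-converse off the semistable-ordinary locus at `2`» (verbatim skeleton v1.7–v2.3), **KEX** = the
2-primary Gross–Zagier index relation for the rank-one member at every `2`-Selmer-trivial-twin prime Heegner frame with `2` split (verbatim
`Uniform.bsdp_of_wall_of_converse_of_kex_of_facts`), and this route's PRINT items `GrossZagierAllLevels` (24148), `MultPublishedInputsAtTwo` (19921),
`EntireLFunctionRat` (19273), `MilneAnyModel` (24149) plus the BCDT modular parametrisation.  CONCLUSION: the item's statement by name.  CONDITIONAL;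
nothing about BSD is proved; closes nothing (KEX is open).  [cite: GrossZagier1986, V.§2 (2.2)] [cite: MazurRubin2010, Thm. 1.5]
[cite: Milne1972ArithmeticAV, §1 Thm. 1] [cite: BCDTJAMS2001, Thm. A] -/
theorem minimalTwinBSDTwo_of_items_of_kex (hOrd : GoodOrdinaryRankZeroAtTwo) (hMult : MultiplicativeRankZeroAtTwo)
    (hSS : SupersingularRankZeroAtTwo) (hAdd : AdditiveRankZeroAtTwo)
    (hC0g : GoodOrdinaryRankZeroTwoConverse) (hC0m : MultiplicativeRankZeroTwoConverse)
    (hC0r : ∀ (V : WeierstrassCurve ℚ) [V.IsElliptic] [V.IsGloballyMinimal], ¬ V.HasCM → ¬ (GoodOrd V 2 ∨ Mult V 2) →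
      V.selmerCorank 2 = 0 → V.analyticRank = 0)
    (hKEX : ∀ (W : WeierstrassCurve ℚ) [W.IsElliptic] [W.IsGloballyMinimal] [NeZero (W.conductorNorm ℤ)],
      ¬ W.HasCM → W.analyticRank = 1 → Nat.card (W.selmerGroup 2) = 2 →
      ∀ (K : Type) [Field K] [NumberField K], IsImaginaryQuadratic K →
        ∀ (ℓ : ℕ), ℓ.Prime → NumberField.discr K = -(ℓ : ℤ) →
        Odd (NumberField.discr K) → NumberField.discr K ≠ -3 → SatisfiesHeegnerHypothesis (W.conductorNorm ℤ) K →
        ((Ideal.span {(2 : ℤ)}).primesOver (𝓞 K)).ncard = 2 →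
        ∀ (Wd : WeierstrassCurve ℚ) [Wd.IsElliptic] [Wd.IsGloballyMinimal],
          (∃ C : VariableChange ℚ, C • W.quadraticTwist (NumberField.discr K : ℚ) = Wd) → Nat.card (Wd.selmerGroup 2) = 1 →
        (W.quadraticTwist (NumberField.discr K : ℚ)).entireLFunction 1 ≠ 0 →
        ∀ (Dt : ModularParametrizationData W (W.conductorNorm ℤ)) (β : ℤ) (ι : K →+* ℂ) (d₁ : KolyvaginHeegnerData Dt β ι 1),
          ∃ M₀ : ℕ,
            (∃ Q : (W.baseChange (ringClassField K ι 1)).toAffine.Point, ((2 ^ M₀ : ℕ) : ℤ) • Q = d₁.derivedPoint) ∧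
            (¬ ∃ Q : (W.baseChange (ringClassField K ι 1)).toAffine.Point, ((2 ^ (M₀ + 1) : ℕ) : ℤ) • Q = d₁.derivedPoint) ∧
            Nat.card (AddCommGroup.primaryComponent (W.baseChange K).sha 2) *
                2 ^ (2 * (padicValInt 2 Dt.c + padicValNat 2 W.tamagawaProduct)) = 2 ^ (2 * M₀))
    (hGZ : GrossZagierAllLevels) (hGZK : MultPublishedInputsAtTwo) (hL : EntireLFunctionRat) (hMi : MilneAnyModel)
    (hMP : nonempty_modularParametrizationData) : MinimalTwinBSDTwo :=
  fun W _ _ hcm hr hSel ↦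
    bsdp_of_wall_of_converse_of_kex_of_facts hGZ hGZK hL hMi hMP (minimalRankZeroBSDTwo_of_wallItems hOrd hMult hSS hAdd)
      (rankZeroTwoConverse_of_items_of_offSemistable hC0g hC0m hC0r) hKEX W hcm hr hSel

/-- ★ **LOSSLESSNESS BY NAME: modulo the items, `MinimalTwinBSDTwo ↔ KEX`.**  With the four WALL row 1 items, the two rank-zero `2`-converse items +
the off-semistable residual, and the PRINT items: the item `MinimalTwinBSDTwo` (stmt-22985) is EQUIVALENT to the single research statement KEX of
skeleton v2.3 (`→`: `Uniform.kexAll_of_minimalTwinBSDTwo_of_wall_of_facts`, which uses only WALL + PRINT; `←`: `minimalTwinBSDTwo_of_items_of_kex`).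
CONDITIONAL on the items; proves neither side; closes nothing.  [cite: GrossZagier1986, V.§2 (2.2)] [cite: Milne1972ArithmeticAV, §1 Thm. 1] -/
theorem minimalTwinBSDTwo_iff_kex_of_items (hOrd : GoodOrdinaryRankZeroAtTwo) (hMult : MultiplicativeRankZeroAtTwo)
    (hSS : SupersingularRankZeroAtTwo) (hAdd : AdditiveRankZeroAtTwo)
    (hC0g : GoodOrdinaryRankZeroTwoConverse) (hC0m : MultiplicativeRankZeroTwoConverse)
    (hC0r : ∀ (V : WeierstrassCurve ℚ) [V.IsElliptic] [V.IsGloballyMinimal], ¬ V.HasCM → ¬ (GoodOrd V 2 ∨ Mult V 2) →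
      V.selmerCorank 2 = 0 → V.analyticRank = 0)
    (hGZ : GrossZagierAllLevels) (hGZK : MultPublishedInputsAtTwo) (hL : EntireLFunctionRat) (hMi : MilneAnyModel)
    (hMP : nonempty_modularParametrizationData) :
    MinimalTwinBSDTwo ↔
      ∀ (W : WeierstrassCurve ℚ) [W.IsElliptic] [W.IsGloballyMinimal] [NeZero (W.conductorNorm ℤ)],
        ¬ W.HasCM → W.analyticRank = 1 → Nat.card (W.selmerGroup 2) = 2 →
        ∀ (K : Type) [Field K] [NumberField K], IsImaginaryQuadratic K →
          ∀ (ℓ : ℕ), ℓ.Prime → NumberField.discr K = -(ℓ : ℤ) →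
          Odd (NumberField.discr K) → NumberField.discr K ≠ -3 → SatisfiesHeegnerHypothesis (W.conductorNorm ℤ) K →
          ((Ideal.span {(2 : ℤ)}).primesOver (𝓞 K)).ncard = 2 →
          ∀ (Wd : WeierstrassCurve ℚ) [Wd.IsElliptic] [Wd.IsGloballyMinimal],
            (∃ C : VariableChange ℚ, C • W.quadraticTwist (NumberField.discr K : ℚ) = Wd) → Nat.card (Wd.selmerGroup 2) = 1 →
          (W.quadraticTwist (NumberField.discr K : ℚ)).entireLFunction 1 ≠ 0 →
          ∀ (Dt : ModularParametrizationData W (W.conductorNorm ℤ)) (β : ℤ) (ι : K →+* ℂ) (d₁ : KolyvaginHeegnerData Dt β ι 1),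
            ∃ M₀ : ℕ,
              (∃ Q : (W.baseChange (ringClassField K ι 1)).toAffine.Point, ((2 ^ M₀ : ℕ) : ℤ) • Q = d₁.derivedPoint) ∧
              (¬ ∃ Q : (W.baseChange (ringClassField K ι 1)).toAffine.Point, ((2 ^ (M₀ + 1) : ℕ) : ℤ) • Q = d₁.derivedPoint) ∧
              Nat.card (AddCommGroup.primaryComponent (W.baseChange K).sha 2) *
                  2 ^ (2 * (padicValInt 2 Dt.c + padicValNat 2 W.tamagawaProduct)) = 2 ^ (2 * M₀) :=
  ⟨fun hTw ↦ kexAll_of_minimalTwinBSDTwo_of_wall_of_facts hGZ hGZK hL hMi (minimalRankZeroBSDTwo_of_wallItems hOrd hMult hSS hAdd) hTw,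
    fun hKEX ↦ minimalTwinBSDTwo_of_items_of_kex hOrd hMult hSS hAdd hC0g hC0m hC0r hKEX hGZ hGZK hL hMi hMP⟩

/-! ## v2.4 «ANALYTIC TWIN» by name: no 2-converse, no residual -/

/-- WALL row 1 BY NAME ⟹ S1′ (BSD₂ for EVERY non-CM globally minimal curve of analytic rank `0`, no Selmer clause): tetrachotomy of the reduction type
at `2`. [folklore] -/
theorem rankZeroBSDTwo_of_wallItems (hOrd : GoodOrdinaryRankZeroAtTwo) (hMult : MultiplicativeRankZeroAtTwo)
    (hSS : SupersingularRankZeroAtTwo) (hAdd : AdditiveRankZeroAtTwo) :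
    ∀ (W : WeierstrassCurve ℚ) [W.IsElliptic] [W.IsGloballyMinimal], ¬ W.HasCM → W.analyticRank = 0 → BSDp W 2 := by
  intro W _ _ hCM hr
  by_cases hg : W.HasGoodReductionAtPrime 2
  · by_cases hd : ((2 : ℕ) : ℤ) ∣ W.frobeniusTrace 2
    · exact hSS W hCM hr ⟨hg, hd⟩
    · exact hOrd W hCM hr ⟨hg, hd⟩
  · by_cases hm : W.HasMultiplicativeReductionAtPrime 2
    · exact hMult W hCM hr hm
    · exact hAdd W hCM hr ⟨hg, hm⟩

/-- ★ **`MinimalTwinBSDTwo` (stmt-BirchSwinnertonDyer-22985) BY NAME from WALL row 1 + KEX′ + PRINT + Friedberg–Hoffstein — NO 2-CONVERSE, NO RESIDUAL.**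
Hypotheses, in order: the four WALL row 1 items (stmt-19095–19098), **KEX′** (the 2-primary Gross–Zagier index relation at every odd Heegner frame with `2`
split and ANY globally minimal twin, verbatim `AnalyticTwin.bsdp_of_wall_of_friedbergHoffstein_of_kex_of_facts`), the PRINT items `GrossZagierAllLevels`
(24148), `MultPublishedInputsAtTwo` (19921), `EntireLFunctionRat` (19273), `MilneAnyModel` (24149), BCDT `nonempty_modularParametrizationData`, and
Friedberg–Hoffstein `friedbergHoffstein_exists_heegnerField_split_twist_ne_zero` (Literature, statement-only, in print).  CONCLUSION: the item's statement
by name.  CONDITIONAL; nothing about BSD is proved; closes nothing (KEX′ is open).  [cite: FriedbergHoffstein1995, main theorem]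
[cite: GrossZagier1986, V.§2 (2.2)] [cite: Milne1972ArithmeticAV, §1 Thm. 1] [cite: BCDTJAMS2001, Thm. A] -/
theorem minimalTwinBSDTwo_of_wallItems_of_friedbergHoffstein_of_kexAny (hOrd : GoodOrdinaryRankZeroAtTwo)
    (hMult : MultiplicativeRankZeroAtTwo) (hSS : SupersingularRankZeroAtTwo) (hAdd : AdditiveRankZeroAtTwo)
    (hKEX : ∀ (W : WeierstrassCurve ℚ) [W.IsElliptic] [W.IsGloballyMinimal] [NeZero (W.conductorNorm ℤ)],
        ¬ W.HasCM → W.analyticRank = 1 → Nat.card (W.selmerGroup 2) = 2 →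
        ∀ (K : Type) [Field K] [NumberField K], IsImaginaryQuadratic K →
          Odd (NumberField.discr K) → NumberField.discr K ≠ -3 → SatisfiesHeegnerHypothesis (W.conductorNorm ℤ) K →
          ((Ideal.span {(2 : ℤ)}).primesOver (𝓞 K)).ncard = 2 →
          ∀ (Wd : WeierstrassCurve ℚ) [Wd.IsElliptic] [Wd.IsGloballyMinimal],
            (∃ C : VariableChange ℚ, C • W.quadraticTwist (NumberField.discr K : ℚ) = Wd) →
          (W.quadraticTwist (NumberField.discr K : ℚ)).entireLFunction 1 ≠ 0 →
          ∀ (Dt : ModularParametrizationData W (W.conductorNorm ℤ)) (β : ℤ) (ι : K →+* ℂ) (d₁ : KolyvaginHeegnerData Dt β ι 1),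
            ∃ M₀ : ℕ,
              (∃ Q : (W.baseChange (ringClassField K ι 1)).toAffine.Point, ((2 ^ M₀ : ℕ) : ℤ) • Q = d₁.derivedPoint) ∧
              (¬ ∃ Q : (W.baseChange (ringClassField K ι 1)).toAffine.Point, ((2 ^ (M₀ + 1) : ℕ) : ℤ) • Q = d₁.derivedPoint) ∧
              Nat.card (AddCommGroup.primaryComponent (W.baseChange K).sha 2) *
                  2 ^ (2 * (padicValInt 2 Dt.c + padicValNat 2 W.tamagawaProduct)) = 2 ^ (2 * M₀))
    (hGZ : GrossZagierAllLevels) (hGZK : MultPublishedInputsAtTwo) (hL : EntireLFunctionRat) (hMi : MilneAnyModel)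
    (hMP : nonempty_modularParametrizationData) (hFH : friedbergHoffstein_exists_heegnerField_split_twist_ne_zero) : MinimalTwinBSDTwo :=
  fun W _ _ hcm hr hSel ↦
    bsdp_of_wall_of_friedbergHoffstein_of_kex_of_facts hGZ hGZK hL hMi hMP hFH (rankZeroBSDTwo_of_wallItems hOrd hMult hSS hAdd) hKEX W
      hcm hr hSel

/-- ★ **LOSSLESSNESS BY NAME (v2.4): modulo WALL row 1 + PRINT + Friedberg–Hoffstein, `MinimalTwinBSDTwo ↔ KEX′`** (`→`:
`AnalyticTwin.kexAny_of_minimalTwinBSDTwo_of_wall_of_facts`, WALL + PRINT only; `←`: `minimalTwinBSDTwo_of_wallItems_of_friedbergHoffstein_of_kexAny`).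
CONDITIONAL on the items; proves neither side; closes nothing.  [cite: GrossZagier1986, V.§2 (2.2)] [cite: FriedbergHoffstein1995, main theorem] -/
theorem minimalTwinBSDTwo_iff_kexAny_of_wallItems (hOrd : GoodOrdinaryRankZeroAtTwo) (hMult : MultiplicativeRankZeroAtTwo)
    (hSS : SupersingularRankZeroAtTwo) (hAdd : AdditiveRankZeroAtTwo)
    (hGZ : GrossZagierAllLevels) (hGZK : MultPublishedInputsAtTwo) (hL : EntireLFunctionRat) (hMi : MilneAnyModel)
    (hMP : nonempty_modularParametrizationData) (hFH : friedbergHoffstein_exists_heegnerField_split_twist_ne_zero) :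
    MinimalTwinBSDTwo ↔
      ∀ (W : WeierstrassCurve ℚ) [W.IsElliptic] [W.IsGloballyMinimal] [NeZero (W.conductorNorm ℤ)],
        ¬ W.HasCM → W.analyticRank = 1 → Nat.card (W.selmerGroup 2) = 2 →
        ∀ (K : Type) [Field K] [NumberField K], IsImaginaryQuadratic K →
          Odd (NumberField.discr K) → NumberField.discr K ≠ -3 → SatisfiesHeegnerHypothesis (W.conductorNorm ℤ) K →
          ((Ideal.span {(2 : ℤ)}).primesOver (𝓞 K)).ncard = 2 →
          ∀ (Wd : WeierstrassCurve ℚ) [Wd.IsElliptic] [Wd.IsGloballyMinimal],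
            (∃ C : VariableChange ℚ, C • W.quadraticTwist (NumberField.discr K : ℚ) = Wd) →
          (W.quadraticTwist (NumberField.discr K : ℚ)).entireLFunction 1 ≠ 0 →
          ∀ (Dt : ModularParametrizationData W (W.conductorNorm ℤ)) (β : ℤ) (ι : K →+* ℂ) (d₁ : KolyvaginHeegnerData Dt β ι 1),
            ∃ M₀ : ℕ,
              (∃ Q : (W.baseChange (ringClassField K ι 1)).toAffine.Point, ((2 ^ M₀ : ℕ) : ℤ) • Q = d₁.derivedPoint) ∧
              (¬ ∃ Q : (W.baseChange (ringClassField K ι 1)).toAffine.Point, ((2 ^ (M₀ + 1) : ℕ) : ℤ) • Q = d₁.derivedPoint) ∧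
              Nat.card (AddCommGroup.primaryComponent (W.baseChange K).sha 2) *
                  2 ^ (2 * (padicValInt 2 Dt.c + padicValNat 2 W.tamagawaProduct)) = 2 ^ (2 * M₀) :=
  ⟨fun hTw ↦ kexAny_of_minimalTwinBSDTwo_of_wall_of_facts hGZ hGZK hL hMi (rankZeroBSDTwo_of_wallItems hOrd hMult hSS hAdd) hTw,
    fun hKEX ↦ minimalTwinBSDTwo_of_wallItems_of_friedbergHoffstein_of_kexAny hOrd hMult hSS hAdd hKEX hGZ hGZK hL hMi hMP hFH⟩

/-! ## The K4 leaf by name: given WALL row 1 (items) + PRINT + FH, `NonCMAtTwo ↔ IDX` -/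

/-- ★ **THE K4 LEAF BY NAME: given the four WALL row 1 ITEMS of route ByReductionTypeAtTwo (stmt-19095–19098), this route's PRINT items, BCDT and
Friedberg–Hoffstein, `Rank1Residual.NonCMAtTwo` (BSD₂ for every non-CM globally minimal curve of analytic rank `≤ 1`) is EQUIVALENT to IDX** — the
`2`-primary Gross–Zagier index relation `#Ш(W_K)[2^∞] · 4^{ord₂ c + ord₂ C(W)} = 4^{ord₂ [W(K):ℤP_K]}` for non-CM rank-one `W` at every imaginary quadratic
Friedberg–Hoffstein field (`d_K < −4`, Heegner, `2` split, `L(W^{(d_K)},1) ≠ 0`), every datum and every Heegner point `P_K ∈ W(K)`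
(`RankOneTransfer.bsdp_rankOne_of_wall_of_friedbergHoffstein_of_idx_of_facts` / `…idx_of_bsdp_rankLeOne_of_facts`).  A CENSUS statement (LEAD g27
currency: leaf = wall ∧ transfer): CONDITIONAL on the items; proves neither side; closes nothing; BSD is NOT proved.
[cite: GrossZagier1986, V.§2 (2.2)] [cite: FriedbergHoffstein1995, main theorem] [cite: Miller2011LMS, Def. 1.1] -/
theorem nonCMAtTwo_iff_idx_of_wallItems (hOrd : GoodOrdinaryRankZeroAtTwo) (hMult : MultiplicativeRankZeroAtTwo)
    (hSS : SupersingularRankZeroAtTwo) (hAdd : AdditiveRankZeroAtTwo)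
    (hGZ : GrossZagierAllLevels) (hGZK : MultPublishedInputsAtTwo) (hL : EntireLFunctionRat) (hMi : MilneAnyModel)
    (hMP : nonempty_modularParametrizationData) (hFH : friedbergHoffstein_exists_heegnerField_split_twist_ne_zero) :
    Summit.BirchSwinnertonDyer.BirchSwinnertonDyer.Rank1Residual.NonCMAtTwo ↔
      ∀ (W : WeierstrassCurve ℚ) [W.IsElliptic] [W.IsGloballyMinimal] [NeZero (W.conductorNorm ℤ)],
        ¬ W.HasCM → W.analyticRank = 1 →
        ∀ (K : Type) [Field K] [NumberField K], IsImaginaryQuadratic K → NumberField.discr K < -4 →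
          SatisfiesHeegnerHypothesis (W.conductorNorm ℤ) K → SatisfiesHeegnerHypothesis 2 K →
          (W.quadraticTwist (NumberField.discr K : ℚ)).entireLFunction 1 ≠ 0 →
          ∀ (Dt : ModularParametrizationData W (W.conductorNorm ℤ)) (H : HeegnerDatum (W.conductorNorm ℤ) (NumberField.discr K))
            (ι : K →+* ℂ) (P : (W.baseChange K).toAffine.Point),
            WeierstrassCurve.Affine.Point.map ι.toRatAlgHom P = heegnerPointComplex Dt H →
            Nat.card (AddCommGroup.primaryComponent (W.baseChange K).sha 2) *
                2 ^ (2 * (padicValInt 2 Dt.c + padicValNat 2 W.tamagawaProduct)) =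
              2 ^ (2 * padicValNat 2 (AddSubgroup.zmultiples P).index) := by
  have hS1 := rankZeroBSDTwo_of_wallItems hOrd hMult hSS hAdd
  refine ⟨fun h ↦ idx_of_bsdp_rankLeOne_of_facts hGZ hGZK hL hMi hS1 fun W _ _ hcm hr1 ↦ h W hcm (le_of_eq hr1),
    fun hIDX W _ _ hcm hr ↦ ?_⟩
  rcases Nat.le_one_iff_eq_zero_or_eq_one.mp hr with hr0 | hr1
  · exact hS1 W hcm hr0
  · exact bsdp_rankOne_of_wall_of_friedbergHoffstein_of_idx_of_facts hGZ hGZK hL hMi hMP hFH hS1 hIDX W hcm hr1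

end Summit.BirchSwinnertonDyer.BirchSwinnertonDyer.Theorems.GenusExact.TwinSwap.Uniform

end
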